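import Mathlib
import HarnessLib
import Literature.Analysis.FluidPDE.VectorCalculus
import Summits.NavierStokesRegularity.NavierStokesRegularity.Theorems.UnthreadedDoorAntidynamoWallShellMeanBounds

/-!
# Route `UnthreadedDoor` / `ThreadingFlux`, crux `PoloidalLiouville` (stmt-NavierStokesRegularity-1222), antidynamo v2 skeleton
# (sha16 `4ebf5683127b`), WALL `stub_scalarLiouville`: the BALL OBSTRUCTION for the toroidal potential in the ray gauge —
# the interface with the spread of positivity (KNSS 2009 Lemma 2.1, tree `KNSS2009_lemma21_halfball`)

Support file (seat leafhand-ns-unthreadeddoor-2 g5, cell decomp-ns), `--supports stmt-NavierStokesRegularity-1222 --as helper`; theorems only.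
Continues `…Theorems.UnthreadedDoorAntidynamoWallShellMean` / `…WallShellMeanBounds` (files 1–2: the weighted shell-oscillation bound
`|∫_{R₁}^{R₂} r (T(x₀ + rn) − T(x₀ + rn')) dr| ≤ 2V(R₂ − R₁) + πV(R₁ + R₂)` in the wall's slice class `v ∈ C^∞`, `‖v‖ ≤ V`,
`T ∈ C^∞(ℝ³ ∖ {x₀})`, `curl v = ∇T × (x − x₀)` off `x₀`).

THE SHAPE KNSS's ARGUMENT NEEDS.  KNSS prove Theorem 5.2 by pairing an ENGINE — Lemma 2.1: a bounded ancient solution `f` of a drift–diffusion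
law with `sup f = M₁ > 0` is `≥ M₁/2` on parabolic balls `B(ȳ, R) × (t̄ − R², t̄)` of ARBITRARY radius `R` — with an OBSTRUCTION — `|ϖ f| ≤ C`,
which forbids `f ≥ M₁/2` on large balls.  This file supplies the obstruction half for the toroidal potential of the wall, in the RAY GAUGE
`F(x) := T(x) − T(x₀ + ‖x − x₀‖ n₀)` (`n₀` a fixed unit reference direction; `F` is `T` minus a radial function, so `∇F × (x − x₀) = ∇T × (x − x₀)`
off `x₀` — the gauge freedom of `StubToroidalPotential`):

* ★★ `le_div_of_ball_ge` — if `F ≥ μ` on a ball `B(y₀, ρ)` (ANY centre, one time slice) then `μ ≤ (4 + 6π) V / ρ`.  Proof: if the ball is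
  close to the centre (`‖y₀ − x₀‖ ≤ ρ/2`) it meets the reference ray, where `F = 0`; otherwise the radial segment
  `r ↦ x₀ + r n`, `n = (y₀ − x₀)/‖y₀ − x₀‖`, `r ∈ [D, D + ρ/2]` (`D = ‖y₀ − x₀‖`) lies in the ball and `le_of_weightedShell_ge` (file 2) applies.
* ★★ `not_halfballs_rayGauge` — hence, in the time-dependent class with the wall's binders (`v` jointly smooth and bounded by `V`, `T` jointly
  smooth off `x₀`, `curl v(t) = ∇T(t) × (x − x₀)`), NO `M₁ > 0` admits the half-ball conclusion of Lemma 2.1 for `F`: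
  `¬ ∀ R > 0, ∃ y₀, ∃ t₀ < 0, ∀ t ∈ (t₀ − R², t₀), ∀ y ∈ B(y₀, R), y ≠ x₀ → M₁/2 ≤ T(t,y) − T(t, x₀ + ‖y − x₀‖ n₀)`.
  So IF some seat shows that `F` (or `−F`) lies in the solution class of `KNSS2009_lemma21_halfball` (the ENGINE — this is the open content of
  the wall, not claimed here), the wall follows exactly as KNSS p. 10: `sup F ≤ 0`, `inf F ≥ 0`, `T` radial, `curl v = ∇T × (x − x₀) = 0`.

HONEST LABEL: slice-wise kinematics + bookkeeping of the KNSS interface; the ENGINE is NOT supplied; nothing here proves `stub_scalarLiouville`,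
`PoloidalLiouville` (1222) or bears on Navier–Stokes regularity; no summit statement is proved. [folklore]
[cite: KochNadirashviliSereginSverak2009, Lemma 2.1 (arXiv:0709.3599 p. 5) and proof of Thm 5.2 (p. 10)]
-/

noncomputable section

-- the summit and its single sub-problem share the name (CONVENTIONS §1)
set_option linter.dupNamespace false

open scoped Topology InnerProductSpace RealInnerProductSpace ContDiff
open Filter Set Function Metric MeasureTheory intervalIntegral
open Literature.Analysis.FluidPDE

namespace Summit.NavierStokesRegularity.NavierStokesRegularity.Theorems.PoloidalLiouville.Antidynamo

namespace ShellMean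

/-! ### §6 The ball obstruction in the ray gauge -/

/-- ★★ **Ball obstruction (ray gauge).**  In the wall's slice class, fix a unit reference direction `n₀`.  If
`T(x) − T(x₀ + ‖x − x₀‖ n₀) ≥ μ` for every `x ≠ x₀` in a ball `B(y₀, ρ)`, then `μ ≤ (4 + 6π) V / ρ`. [folklore] -/
theorem le_div_of_ball_ge {v : EuclideanSpace ℝ (Fin 3) → EuclideanSpace ℝ (Fin 3)}
    {T : EuclideanSpace ℝ (Fin 3) → ℝ} {x₀ : EuclideanSpace ℝ (Fin 3)} {V μ : ℝ}
    (hv : ContDiff ℝ (⊤ : ℕ∞) v) (hV : ∀ x, ‖v x‖ ≤ V) (hT : ContDiffOn ℝ (⊤ : ℕ∞) T {x₀}ᶜ)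
    (hcurl : ∀ x, x ≠ x₀ → curl v x = cross (gradient T x) (x - x₀))
    {n₀ : EuclideanSpace ℝ (Fin 3)} (hn₀ : ‖n₀‖ = 1) {y₀ : EuclideanSpace ℝ (Fin 3)} {ρ : ℝ} (hρ : 0 < ρ)
    (hμ : ∀ x ∈ ball y₀ ρ, x ≠ x₀ → μ ≤ T x - T (x₀ + ‖x - x₀‖ • n₀)) :
    μ ≤ (4 + 6 * Real.pi) * V / ρ := by
  have hV0 : 0 ≤ V := le_trans (norm_nonneg _) (hV 0)
  have hRHS : 0 ≤ (4 + 6 * Real.pi) * V / ρ := by positivity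
  set D : ℝ := ‖y₀ - x₀‖ with hD
  by_cases hnear : D ≤ ρ / 2
  · -- the ball meets the reference ray, where the ray-gauge deviation vanishes
    set x : EuclideanSpace ℝ (Fin 3) := x₀ + (ρ / 4) • n₀ with hx
    have hxx₀ : x - x₀ = (ρ / 4) • n₀ := by rw [hx]; abel
    have hnorm : ‖x - x₀‖ = ρ / 4 := by
      rw [hxx₀, norm_smul, hn₀, mul_one, Real.norm_eq_abs, abs_of_pos (by positivity)]
    have hne : x ≠ x₀ := by
      intro h
      have : ‖x - x₀‖ = 0 := by rw [h, sub_self, norm_zero]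
      rw [hnorm] at this
      linarith
    have hmem : x ∈ ball y₀ ρ := by
      rw [mem_ball, dist_eq_norm]
      calc ‖x - y₀‖ = ‖(x - x₀) - (y₀ - x₀)‖ := by congr 1; abel
        _ ≤ ‖x - x₀‖ + ‖y₀ - x₀‖ := norm_sub_le _ _
        _ = ρ / 4 + D := by rw [hnorm, hD]
        _ < ρ := by linarith
    have h := hμ x hmem hne
    rw [hnorm, ← hx, sub_self] at h
    exact h.trans hRHS
  · -- the far case: a radial segment of length `ρ/2` inside the ball
    push Not at hnear
    have hDpos : 0 < D := lt_trans (by positivity) hnear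
    have hy : y₀ - x₀ ≠ 0 := norm_pos_iff.mp (by rw [← hD]; exact hDpos)
    set n : EuclideanSpace ℝ (Fin 3) := D⁻¹ • (y₀ - x₀) with hn
    have hn1 : ‖n‖ = 1 := by
      rw [hn, norm_smul, norm_inv, Real.norm_eq_abs, abs_of_pos hDpos, ← hD, inv_mul_cancel₀ hDpos.ne']
    have hyn : y₀ - x₀ = D • n := by
      rw [hn, smul_smul, mul_inv_cancel₀ hDpos.ne', one_smul]
    -- the segment `r ∈ [D, D + ρ/2]` in direction `n` lies in the ball
    have hseg : ∀ r ∈ Icc D (D + ρ / 2), μ ≤ T (x₀ + r • n) - T (x₀ + r • n₀) := by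
      intro r hr
      have hr0 : 0 < r := lt_of_lt_of_le hDpos hr.1
      have hxx₀ : x₀ + r • n - x₀ = r • n := add_sub_cancel_left _ _
      have hnorm : ‖x₀ + r • n - x₀‖ = r := by
        rw [hxx₀, norm_smul, hn1, mul_one, Real.norm_eq_abs, abs_of_pos hr0]
      have hmem : x₀ + r • n ∈ ball y₀ ρ := by
        rw [mem_ball, dist_eq_norm]
        have : x₀ + r • n - y₀ = (r - D) • n := by
          rw [sub_smul, ← hyn]; abel
        rw [this, norm_smul, hn1, mul_one, Real.norm_eq_abs, abs_of_nonneg (by linarith [hr.1])]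
        linarith [hr.2]
      have h := hμ _ hmem (centre_add_smul_ne hn1 hr0.ne')
      rw [hnorm] at h
      exact h
    have h := le_of_weightedShell_ge hv hV hT hcurl hn1 hn₀ hDpos (by linarith) hseg
    -- `μ D (ρ/2) ≤ 2V(ρ/2) + πV(2D + ρ/2)`, and `D > ρ/2`
    have h1 : μ * D * (D + ρ / 2 - D) = (μ * D) * (ρ / 2) := by ring
    rw [h1] at h
    by_cases hμ0 : μ ≤ 0
    · exact hμ0.trans hRHS
    push Not at hμ0
    rw [le_div_iff₀ hρ]
    -- from `h`: `μ D ρ ≤ 2Vρ + πV(4D + ρ)`; then use `ρ < 2D` and divide by `D`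
    have h2 : μ * D * ρ ≤ 2 * V * ρ + Real.pi * V * (4 * D + ρ) := by linarith
    have hρD : ρ ≤ 2 * D := by linarith
    have e1 : 2 * V * ρ ≤ 2 * V * (2 * D) := mul_le_mul_of_nonneg_left hρD (by positivity)
    have e2 : Real.pi * V * ρ ≤ Real.pi * V * (2 * D) :=
      mul_le_mul_of_nonneg_left hρD (mul_nonneg Real.pi_pos.le hV0)
    have h4 : μ * ρ * D ≤ (4 + 6 * Real.pi) * V * D := by linarith
    exact le_of_mul_le_mul_right h4 hDpos

/-! ### §7 The interface with KNSS's Lemma 2.1: no half-balls for the ray-gauge deviation -/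

/-- ★★ **No half-balls for the ray-gauge deviation.**  In the time-dependent class with the wall's binders (`v` jointly smooth on the slab and
bounded by `V`, `T` jointly smooth on the punctured slab, `curl v(t) = ∇T(t) × (x − x₀)`), for every unit `n₀` and every `M₁ > 0` the conclusion
of KNSS's Lemma 2.1 (`KNSS2009_lemma21_halfball`: `f ≥ M₁/2` on parabolic balls of every radius) FAILS for
`f(t, y) = T(t, y) − T(t, x₀ + ‖y − x₀‖ n₀)`. [folklore] -/
theorem not_halfballs_rayGauge
    {v : ℝ → EuclideanSpace ℝ (Fin 3) → EuclideanSpace ℝ (Fin 3)} {x₀ : EuclideanSpace ℝ (Fin 3)}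
    {T : ℝ → EuclideanSpace ℝ (Fin 3) → ℝ} {V M₁ : ℝ}
    (hsm : ContDiffOn ℝ (⊤ : ℕ∞) (Function.uncurry v) (Set.Iio 0 ×ˢ Set.univ))
    (hsT : ContDiffOn ℝ (⊤ : ℕ∞) (Function.uncurry T) (Set.Iio 0 ×ˢ ({x₀}ᶜ : Set (EuclideanSpace ℝ (Fin 3)))))
    (hV : ∀ t < 0, ∀ x, ‖v t x‖ ≤ V)
    (hrep : ∀ t < 0, ∀ x, curl (v t) x = cross (gradient (T t) x) (x - x₀))
    {n₀ : EuclideanSpace ℝ (Fin 3)} (hn₀ : ‖n₀‖ = 1) (hM₁ : 0 < M₁) :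
    ¬ ∀ R > 0, ∃ y₀ : EuclideanSpace ℝ (Fin 3), ∃ t₀ < (0 : ℝ),
        ∀ t ∈ Ioo (t₀ - R ^ 2) t₀, ∀ y ∈ ball y₀ R, y ≠ x₀ →
          M₁ / 2 ≤ T t y - T t (x₀ + ‖y - x₀‖ • n₀) := by
  intro hball
  have hV0 : 0 ≤ V := le_trans (norm_nonneg _) (hV (-1) (by norm_num) 0)
  -- a radius beating the obstruction constant
  set R : ℝ := 4 * (4 + 6 * Real.pi) * V / M₁ + 1 with hR
  have hRpos : 0 < R := by positivity
  obtain ⟨y₀, t₀, ht₀, h⟩ := hball R hRpos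
  -- a time inside the parabolic ball
  set t : ℝ := t₀ - R ^ 2 / 2 with ht
  have htI : t ∈ Ioo (t₀ - R ^ 2) t₀ := by
    constructor <;> · rw [ht]; nlinarith
  have htneg : t < 0 := lt_trans htI.2 ht₀
  -- slice regularity
  have hι : ContDiff ℝ (⊤ : ℕ∞) fun x : EuclideanSpace ℝ (Fin 3) => (t, x) := contDiff_prodMk_right t
  have hv : ContDiff ℝ (⊤ : ℕ∞) (v t) := hsm.comp_contDiff hι fun x => ⟨htneg, Set.mem_univ x⟩
  have hT : ContDiffOn ℝ (⊤ : ℕ∞) (T t) ({x₀}ᶜ) := hsT.comp hι.contDiffOn fun x hx => ⟨htneg, hx⟩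
  have hobs := le_div_of_ball_ge hv (hV t htneg) hT (fun x _ => hrep t htneg x) hn₀ hRpos
    (fun y hy hyx => h t htI y hy hyx)
  -- `M₁/2 ≤ (4 + 6π) V / R` with `R > 4 (4 + 6π) V / M₁`: contradiction
  rw [le_div_iff₀ hRpos] at hobs
  have hRM : M₁ / 2 * R = 2 * ((4 + 6 * Real.pi) * V) + M₁ / 2 := by
    rw [hR]
    field_simp
    ring
  have hK : 0 ≤ (4 + 6 * Real.pi) * V := mul_nonneg (by positivity) hV0
  linarith

end ShellMean

end Summit.NavierStokesRegularity.NavierStokesRegularity.Theorems.PoloidalLiouville.Antidynamo
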